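import Summits.QuantumFields.YangMills.Theorems.SmallCircleAnchorAnchorGapStubDebyeScreening17

/-!
# Crux `AnchorGap` (stmt-QuantumFields-11141), line `registered` — Wick identities in covariance form (B1 toolkit under stub X₀)

Generic finite-dimensional Gaussian calculus for the weight `w_P(φ) = e^{−½φᵀPφ}` of a positive
definite precision matrix `P` on `ι → ℝ` (product Lebesgue measure), continuing the integration by
parts engine `gaussian_ibp` of `…StubDebyeScreening17`:

* `posDef_coercive` — a positive definite real matrix is coercive: `c Σ φᵢ² ≤ φᵀPφ`, `c > 0`;
* `integrable_polyGrowth_mul_gaussian` — a measurable `F` with `|F| ≤ K (1 + Σφᵢ²)^m` is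
  integrable against `w_P` (domination by a product Gaussian);
* `gaussian_wick_one` — `∫ φ_p F w_P = Σ_a P⁻¹_{pa} ∫ ∂_a F w_P`;
* `gaussian_wick_two` — `∫ φ_p φ_q F w_P = P⁻¹_{pq} ∫ F w_P + Σ_{a,b} P⁻¹_{pa} P⁻¹_{qb} ∫ ∂_b∂_a F w_P`;
* `gaussian_wick_quadForm` — `∫ (φᵀDφ) F w_P = (Σ_{pq} D_{pq} P⁻¹_{pq}) ∫ F w_P + Σ_{a,b} (P⁻¹DP⁻¹)_{ab} ∫ ∂_b∂_a F w_P`,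

for `F` in the polynomial-growth class (measurable, everywhere-defined coordinate partial derivatives
of polynomial growth); the last identity is the integrand of the Gaussian interpolation (heat-kernel)
formula behind the Glimm–Jaffe–Spencer decoupling expansion (Brydges 1978 §3, (3.13)–(3.17)).
-/

set_option autoImplicit false

noncomputable section

namespace Summit.QuantumFields.YangMills.Theorems.AnchorGap

open MeasureTheory Finset Matrix

/-- **Positive definite real matrices are coercive**: there is `c > 0` with `c Σᵢ φᵢ² ≤ φᵀPφ`
(minimum of the form on the compact sup-norm unit sphere, scaling, `Σᵢ φᵢ² ≤ |ι| ‖φ‖²_∞`). [folklore] -/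
theorem posDef_coercive :
    ∀ (ι : Type) [Fintype ι] (P : Matrix ι ι ℝ), P.PosDef → ∃ c : ℝ, 0 < c ∧ ∀ φ : ι → ℝ, c * ∑ i, φ i ^ 2 ≤ φ ⬝ᵥ (P *ᵥ φ) := by
  intro ι _ P hP
  classical
  have hq : Continuous fun φ : ι → ℝ => φ ⬝ᵥ (P *ᵥ φ) :=
    continuous_id.dotProduct (Continuous.matrix_mulVec continuous_const continuous_id)
  have hpos : ∀ φ : ι → ℝ, φ ≠ 0 → 0 < φ ⬝ᵥ (P *ᵥ φ) := fun φ hφ => by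
    simpa using hP.dotProduct_mulVec_pos hφ
  have hnn : ∀ φ : ι → ℝ, 0 ≤ φ ⬝ᵥ (P *ᵥ φ) := fun φ => by
    simpa using hP.posSemidef.dotProduct_mulVec_nonneg φ
  cases isEmpty_or_nonempty ι with
  | inl h =>
      refine ⟨1, one_pos, fun φ => ?_⟩
      simp [Finset.univ_eq_empty, dotProduct]
  | inr h =>
      obtain ⟨i₀⟩ := h
      -- minimum of the form on the unit sphere of the sup norm
      have hcpt : IsCompact (Metric.sphere (0 : ι → ℝ) 1) := isCompact_sphere _ _
      have hne : (Metric.sphere (0 : ι → ℝ) 1).Nonempty :=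
        ⟨Pi.single i₀ 1, by simp [Pi.norm_single]⟩
      obtain ⟨ψ₀, hψ₀, hmin⟩ := hcpt.exists_isMinOn hne hq.continuousOn
      have hψ₀ne : ψ₀ ≠ 0 := by
        intro h0; rw [h0] at hψ₀; simp at hψ₀
      set c₀ := ψ₀ ⬝ᵥ (P *ᵥ ψ₀) with hc₀
      have hc₀pos : 0 < c₀ := hpos ψ₀ hψ₀ne
      haveI : Nonempty ι := ⟨i₀⟩
      have hcard : (0 : ℝ) < Fintype.card ι := by exact_mod_cast Fintype.card_pos
      refine ⟨c₀ / Fintype.card ι, div_pos hc₀pos hcard, fun φ => ?_⟩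
      -- `Σ φᵢ² ≤ |ι| ‖φ‖²`
      have hsum : ∑ i, φ i ^ 2 ≤ Fintype.card ι * ‖φ‖ ^ 2 := by
        calc ∑ i, φ i ^ 2 ≤ ∑ _i : ι, ‖φ‖ ^ 2 := Finset.sum_le_sum fun i _ => by
                have h1 : |φ i| ≤ ‖φ‖ := by simpa [Real.norm_eq_abs] using norm_le_pi_norm φ i
                have h2 : φ i ^ 2 = |φ i| ^ 2 := (sq_abs _).symm
                rw [h2]; gcongr
          _ = Fintype.card ι * ‖φ‖ ^ 2 := by simp [Finset.sum_const, Finset.card_univ]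
      by_cases hφ : φ = 0
      · subst hφ; simp [dotProduct]
      · have hnorm : 0 < ‖φ‖ := norm_pos_iff.2 hφ
        set ψ : ι → ℝ := ‖φ‖⁻¹ • φ with hψ
        have hψmem : ψ ∈ Metric.sphere (0 : ι → ℝ) 1 := by
          rw [mem_sphere_zero_iff_norm, hψ, norm_smul, norm_inv, norm_norm, inv_mul_cancel₀ hnorm.ne']
        have hle : c₀ ≤ ψ ⬝ᵥ (P *ᵥ ψ) := hmin hψmem
        have hscale : φ ⬝ᵥ (P *ᵥ φ) = ‖φ‖ ^ 2 * (ψ ⬝ᵥ (P *ᵥ ψ)) := by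
          have : φ = ‖φ‖ • ψ := by rw [hψ, smul_smul, mul_inv_cancel₀ hnorm.ne', one_smul]
          conv_lhs => rw [this]
          rw [Matrix.mulVec_smul, smul_dotProduct, dotProduct_smul, smul_eq_mul, smul_eq_mul]
          ring
        rw [hscale]
        calc c₀ / Fintype.card ι * ∑ i, φ i ^ 2 ≤ c₀ / Fintype.card ι * (Fintype.card ι * ‖φ‖ ^ 2) := by
                gcongr
          _ = ‖φ‖ ^ 2 * c₀ := by field_simp
          _ ≤ ‖φ‖ ^ 2 * (ψ ⬝ᵥ (P *ᵥ ψ)) := by gcongr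

/-- **Gaussian domination of the polynomial-growth class.** For a positive definite `P`, a
measurable `F` with `|F(φ)| ≤ K (1 + Σᵢ φᵢ²)^m` is integrable against `e^{−½φᵀPφ}`: with
`c Σφᵢ² ≤ φᵀPφ` and `a = c/4`, `(1+s)^m ≤ m! a^{−m} e^{a(1+s)}` gives the product-Gaussian majorant
`|F| e^{−½φᵀPφ} ≤ K m! a^{−m} e^{a} Πᵢ e^{−a φᵢ²}`. [folklore] -/
theorem integrable_polyGrowth_mul_gaussian :
    ∀ (ι : Type) [Fintype ι] (P : Matrix ι ι ℝ), P.PosDef → ∀ (m : ℕ) (K : ℝ) (F : (ι → ℝ) → ℝ), AEStronglyMeasurable F volume → (∀ φ : ι → ℝ, |F φ| ≤ K * (1 + ∑ i, φ i ^ 2) ^ m) → Integrable (fun φ : ι → ℝ => F φ * Real.exp (-(φ ⬝ᵥ (P *ᵥ φ)) / 2)) := by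
  intro ι _ P hP m K F hF hbound
  obtain ⟨c, hc, hcoer⟩ := posDef_coercive ι P hP
  set a : ℝ := c / 4 with ha
  have ha0 : 0 < a := by positivity
  have hpoly : ∀ s : ℝ, 0 ≤ s → (1 + s) ^ m ≤ (m.factorial : ℝ) * a⁻¹ ^ m * Real.exp (a * (1 + s)) := by
    intro s hs
    have h := Real.pow_div_factorial_le_exp (x := a * (1 + s)) (by positivity) m
    rw [div_le_iff₀ (by positivity), mul_pow] at h
    have hapos : 0 < a ^ m := pow_pos ha0 m
    calc (1 + s) ^ m = (a ^ m)⁻¹ * (a ^ m * (1 + s) ^ m) := by field_simp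
      _ ≤ (a ^ m)⁻¹ * (Real.exp (a * (1 + s)) * m.factorial) := by gcongr
      _ = (m.factorial : ℝ) * a⁻¹ ^ m * Real.exp (a * (1 + s)) := by rw [inv_pow]; ring
  have hdom : Integrable (fun φ : ι → ℝ =>
      (|K| * ((m.factorial : ℝ) * a⁻¹ ^ m * Real.exp a)) * ∏ i, Real.exp (-a * φ i ^ 2)) := by
    refine Integrable.const_mul ?_ _
    exact Integrable.fintype_prod (f := fun _ : ι => fun t : ℝ => Real.exp (-a * t ^ 2))
      fun _ => integrable_exp_neg_mul_sq ha0
  have hwcont : Continuous fun φ : ι → ℝ => Real.exp (-(φ ⬝ᵥ (P *ᵥ φ)) / 2) := by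
    refine Real.continuous_exp.comp ((Continuous.neg ?_).div_const _)
    exact continuous_id.dotProduct (Continuous.matrix_mulVec continuous_const continuous_id)
  refine hdom.mono' (hF.mul hwcont.aestronglyMeasurable) (Filter.Eventually.of_forall fun φ => ?_)
  set s : ℝ := ∑ i, φ i ^ 2 with hs
  have hs0 : 0 ≤ s := Finset.sum_nonneg fun i _ => sq_nonneg _
  rw [Real.norm_eq_abs, abs_mul, Real.abs_exp]
  have h1 : |F φ| ≤ |K| * (1 + s) ^ m :=
    (hbound φ).trans (mul_le_mul_of_nonneg_right (le_abs_self K) (by positivity))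
  have h2 : Real.exp (-(φ ⬝ᵥ (P *ᵥ φ)) / 2) ≤ Real.exp (-(2 * a * s)) := by
    refine Real.exp_le_exp.2 ?_
    have := hcoer φ
    rw [ha]; linarith
  have h3 : ∏ i, Real.exp (-a * φ i ^ 2) = Real.exp (-(a * s)) := by
    rw [← Real.exp_sum, hs, Finset.mul_sum, ← Finset.sum_neg_distrib]
    congr 1
    exact Finset.sum_congr rfl fun i _ => by ring
  rw [h3]
  calc |F φ| * Real.exp (-(φ ⬝ᵥ (P *ᵥ φ)) / 2) ≤ (|K| * (1 + s) ^ m) * Real.exp (-(2 * a * s)) := by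
          gcongr
    _ ≤ (|K| * ((m.factorial : ℝ) * a⁻¹ ^ m * Real.exp (a * (1 + s)))) * Real.exp (-(2 * a * s)) := by
          gcongr
          exact hpoly s hs0
    _ = |K| * ((m.factorial : ℝ) * a⁻¹ ^ m) * (Real.exp (a * (1 + s)) * Real.exp (-(2 * a * s))) := by ring
    _ = |K| * ((m.factorial : ℝ) * a⁻¹ ^ m) * (Real.exp a * Real.exp (-(a * s))) := by
          have hexp : Real.exp (a * (1 + s)) * Real.exp (-(2 * a * s)) = Real.exp a * Real.exp (-(a * s)) := by
            rw [← Real.exp_add, ← Real.exp_add]; ring_nf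
          rw [hexp]
    _ = |K| * ((m.factorial : ℝ) * a⁻¹ ^ m * Real.exp a) * Real.exp (-(a * s)) := by ring

/-- `|φ_j| ≤ 1 + Σᵢ φᵢ²`. -/
private lemma abs_apply_le_one_add_sum_sq {ι : Type} [Fintype ι] (φ : ι → ℝ) (j : ι) :
    |φ j| ≤ 1 + ∑ i, φ i ^ 2 := by
  have h1 : |φ j| ≤ 1 + φ j ^ 2 := by nlinarith [abs_nonneg (φ j), sq_abs (φ j)]
  have h2 : φ j ^ 2 ≤ ∑ i, φ i ^ 2 :=
    Finset.single_le_sum (f := fun i => φ i ^ 2) (fun i _ => sq_nonneg _) (Finset.mem_univ j)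
  linarith

/-- `|(Pφ)_a| ≤ (Σ_j |P_{aj}|)(1 + Σᵢ φᵢ²)`. -/
private lemma abs_mulVec_le {ι : Type} [Fintype ι] (P : Matrix ι ι ℝ) (φ : ι → ℝ) (a : ι) :
    |(P *ᵥ φ) a| ≤ (∑ j, |P a j|) * (1 + ∑ i, φ i ^ 2) := by
  rw [Matrix.mulVec, dotProduct, Finset.sum_mul]
  refine (Finset.abs_sum_le_sum_abs _ _).trans (Finset.sum_le_sum fun j _ => ?_)
  rw [abs_mul]
  exact mul_le_mul_of_nonneg_left (abs_apply_le_one_add_sum_sq φ j) (abs_nonneg _)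

/-- The constant of a polynomial-growth bound is non-negative. -/
private lemma nonneg_of_bound {ι : Type} [Fintype ι] {m : ℕ} {K : ℝ} {F : (ι → ℝ) → ℝ}
    (h : ∀ φ : ι → ℝ, |F φ| ≤ K * (1 + ∑ i, φ i ^ 2) ^ m) : 0 ≤ K := by
  have := h 0; simp at this; exact (abs_nonneg _).trans this

/-- Products with a coordinate stay in the polynomial-growth class (one degree up). -/
private lemma bound_coord_mul {ι : Type} [Fintype ι] {m : ℕ} {K : ℝ} {F : (ι → ℝ) → ℝ}
    (h : ∀ φ : ι → ℝ, |F φ| ≤ K * (1 + ∑ i, φ i ^ 2) ^ m) (q : ι) :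
    ∀ φ : ι → ℝ, |φ q * F φ| ≤ K * (1 + ∑ i, φ i ^ 2) ^ (m + 1) := by
  intro φ
  have hK := nonneg_of_bound h
  have hs : 0 ≤ ∑ i, φ i ^ 2 := Finset.sum_nonneg fun i _ => sq_nonneg _
  rw [abs_mul, pow_succ]
  calc |φ q| * |F φ| ≤ (1 + ∑ i, φ i ^ 2) * (K * (1 + ∑ i, φ i ^ 2) ^ m) :=
        mul_le_mul (abs_apply_le_one_add_sum_sq φ q) (h φ) (abs_nonneg _) (by positivity)
    _ = K * ((1 + ∑ i, φ i ^ 2) ^ m * (1 + ∑ i, φ i ^ 2)) := by ring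

/-- Products with `(Pφ)_a` stay in the polynomial-growth class (one degree up). -/
private lemma bound_mulVec_mul {ι : Type} [Fintype ι] {m : ℕ} {K : ℝ} {F : (ι → ℝ) → ℝ}
    (h : ∀ φ : ι → ℝ, |F φ| ≤ K * (1 + ∑ i, φ i ^ 2) ^ m) (P : Matrix ι ι ℝ) (a : ι) :
    ∀ φ : ι → ℝ, |F φ * (P *ᵥ φ) a| ≤ (K * ∑ j, |P a j|) * (1 + ∑ i, φ i ^ 2) ^ (m + 1) := by
  intro φ
  have hK := nonneg_of_bound h
  have hs : 0 ≤ ∑ i, φ i ^ 2 := Finset.sum_nonneg fun i _ => sq_nonneg _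
  rw [abs_mul, pow_succ]
  calc |F φ| * |(P *ᵥ φ) a| ≤ (K * (1 + ∑ i, φ i ^ 2) ^ m) * ((∑ j, |P a j|) * (1 + ∑ i, φ i ^ 2)) :=
        mul_le_mul (h φ) (abs_mulVec_le P φ a) (abs_nonneg _) (by positivity)
    _ = (K * ∑ j, |P a j|) * ((1 + ∑ i, φ i ^ 2) ^ m * (1 + ∑ i, φ i ^ 2)) := by ring

/-- A bound of degree `m` is also a bound of degree `m + 1`. -/
private lemma bound_mono {ι : Type} [Fintype ι] {m : ℕ} {K : ℝ} {F : (ι → ℝ) → ℝ}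
    (h : ∀ φ : ι → ℝ, |F φ| ≤ K * (1 + ∑ i, φ i ^ 2) ^ m) :
    ∀ φ : ι → ℝ, |F φ| ≤ K * (1 + ∑ i, φ i ^ 2) ^ (m + 1) := by
  intro φ
  have hK := nonneg_of_bound h
  have hs : 0 ≤ ∑ i, φ i ^ 2 := Finset.sum_nonneg fun i _ => sq_nonneg _
  refine (h φ).trans (mul_le_mul_of_nonneg_left ?_ hK)
  exact pow_le_pow_right₀ (by linarith) (Nat.le_succ m)

/-- **Wick's rule, first order (covariance form of Gaussian integration by parts).** For a
positive definite precision matrix `P` on `ι → ℝ` and `F` in the polynomial-growth class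
(measurable, `|F|, |∂_a F| ≤ K(1 + Σφᵢ²)^m`, everywhere-defined coordinate partial derivatives
`∂_a F = F₁ a`): `∫ φ_p F e^{−½φᵀPφ} dφ = Σ_a P⁻¹_{pa} ∫ ∂_a F e^{−½φᵀPφ} dφ`
(`gaussian_ibp` contracted with `P⁻¹`). [folklore] -/
theorem gaussian_wick_one :
    ∀ (ι : Type) [Fintype ι] [DecidableEq ι] (P : Matrix ι ι ℝ), P.PosDef → ∀ (m : ℕ) (K : ℝ) (F : (ι → ℝ) → ℝ) (F₁ : ι → (ι → ℝ) → ℝ), AEStronglyMeasurable F volume → (∀ a : ι, AEStronglyMeasurable (F₁ a) volume) → (∀ φ : ι → ℝ, |F φ| ≤ K * (1 + ∑ i, φ i ^ 2) ^ m) → (∀ (a : ι) (φ : ι → ℝ), |F₁ a φ| ≤ K * (1 + ∑ i, φ i ^ 2) ^ m) → (∀ (a : ι) (φ : ι → ℝ), HasDerivAt (fun t : ℝ => F (Function.update φ a t)) (F₁ a φ) (φ a)) → ∀ p : ι, ∫ φ : ι → ℝ, φ p * F φ * Real.exp (-(φ ⬝ᵥ (P *ᵥ φ)) / 2) = ∑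 a : ι, P⁻¹ p a * ∫ φ : ι → ℝ, F₁ a φ * Real.exp (-(φ ⬝ᵥ (P *ᵥ φ)) / 2) := by
  intro ι _ _ P hP m K F F₁ hFm hF₁m hFb hF₁b hderiv p
  have hsymm : P.IsSymm := Matrix.isHermitian_iff_isSymm.1 hP.isHermitian
  have hdet : IsUnit P.det := (Matrix.isUnit_iff_isUnit_det P).1 hP.isUnit
  have hwcont : Continuous fun φ : ι → ℝ => Real.exp (-(φ ⬝ᵥ (P *ᵥ φ)) / 2) := by
    refine Real.continuous_exp.comp ((Continuous.neg ?_).div_const _)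
    exact continuous_id.dotProduct (Continuous.matrix_mulVec continuous_const continuous_id)
  have hmv : ∀ a : ι, Continuous fun φ : ι → ℝ => (P *ᵥ φ) a := fun a =>
    (continuous_apply a).comp (Continuous.matrix_mulVec continuous_const continuous_id)
  -- integrability
  have hiF : Integrable (fun φ : ι → ℝ => F φ * Real.exp (-(φ ⬝ᵥ (P *ᵥ φ)) / 2)) :=
    integrable_polyGrowth_mul_gaussian ι P hP m K F hFm hFb
  have hiF₁ : ∀ a, Integrable (fun φ : ι → ℝ => F₁ a φ * Real.exp (-(φ ⬝ᵥ (P *ᵥ φ)) / 2)) := fun a =>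
    integrable_polyGrowth_mul_gaussian ι P hP m K (F₁ a) (hF₁m a) (hF₁b a)
  have hiFP : ∀ a, Integrable (fun φ : ι → ℝ => F φ * (P *ᵥ φ) a * Real.exp (-(φ ⬝ᵥ (P *ᵥ φ)) / 2)) :=
    fun a => integrable_polyGrowth_mul_gaussian ι P hP (m + 1) (K * ∑ j, |P a j|) (fun φ => F φ * (P *ᵥ φ) a)
      (hFm.mul (hmv a).aestronglyMeasurable) (bound_mulVec_mul hFb P a)
  have hibp : ∀ a, ∫ φ : ι → ℝ, F₁ a φ * Real.exp (-(φ ⬝ᵥ (P *ᵥ φ)) / 2) =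
      ∫ φ : ι → ℝ, F φ * (P *ᵥ φ) a * Real.exp (-(φ ⬝ᵥ (P *ᵥ φ)) / 2) := fun a =>
    gaussian_ibp ι P hsymm a F (F₁ a) (hderiv a) hiF (hiF₁ a) (hiFP a)
  -- `Σ_a P⁻¹_{pa} (Pφ)_a = φ_p`
  have hCP : ∀ φ : ι → ℝ, ∑ a, P⁻¹ p a * (P *ᵥ φ) a = φ p := fun φ => by
    have h1 : (P⁻¹ *ᵥ (P *ᵥ φ)) p = φ p := by
      rw [Matrix.mulVec_mulVec, Matrix.nonsing_inv_mul P hdet, Matrix.one_mulVec]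
    rw [← h1]
    rfl
  have hpt : ∀ φ : ι → ℝ, ∑ a, P⁻¹ p a * (F φ * (P *ᵥ φ) a * Real.exp (-(φ ⬝ᵥ (P *ᵥ φ)) / 2)) =
      φ p * F φ * Real.exp (-(φ ⬝ᵥ (P *ᵥ φ)) / 2) := fun φ => by
    have : ∑ a, P⁻¹ p a * (F φ * (P *ᵥ φ) a * Real.exp (-(φ ⬝ᵥ (P *ᵥ φ)) / 2)) =
        (∑ a, P⁻¹ p a * (P *ᵥ φ) a) * (F φ * Real.exp (-(φ ⬝ᵥ (P *ᵥ φ)) / 2)) := by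
      rw [Finset.sum_mul]
      exact Finset.sum_congr rfl fun a _ => by ring
    rw [this, hCP φ]
    ring
  calc ∫ φ : ι → ℝ, φ p * F φ * Real.exp (-(φ ⬝ᵥ (P *ᵥ φ)) / 2)
      = ∫ φ : ι → ℝ, ∑ a, P⁻¹ p a * (F φ * (P *ᵥ φ) a * Real.exp (-(φ ⬝ᵥ (P *ᵥ φ)) / 2)) :=
        integral_congr_ae (Filter.Eventually.of_forall fun φ => (hpt φ).symm)
    _ = ∑ a, ∫ φ : ι → ℝ, P⁻¹ p a * (F φ * (P *ᵥ φ) a * Real.exp (-(φ ⬝ᵥ (P *ᵥ φ)) / 2)) :=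
        integral_finsetSum _ fun a _ => (hiFP a).const_mul _
    _ = ∑ a, P⁻¹ p a * ∫ φ : ι → ℝ, F φ * (P *ᵥ φ) a * Real.exp (-(φ ⬝ᵥ (P *ᵥ φ)) / 2) :=
        Finset.sum_congr rfl fun a _ => integral_const_mul _ _
    _ = ∑ a, P⁻¹ p a * ∫ φ : ι → ℝ, F₁ a φ * Real.exp (-(φ ⬝ᵥ (P *ᵥ φ)) / 2) :=
        Finset.sum_congr rfl fun a _ => by rw [hibp a]

/-- **Wick's rule, second order.** For a positive definite precision matrix `P` and `F` in the
polynomial-growth class with first and second coordinate partial derivatives `∂_a F = F₁ a`,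
`∂_b ∂_a F = F₂ a b` in the same class:
`∫ φ_p φ_q F e^{−½φᵀPφ} = P⁻¹_{pq} ∫ F e^{−½φᵀPφ} + Σ_{a,b} P⁻¹_{pa} P⁻¹_{qb} ∫ ∂_b∂_a F e^{−½φᵀPφ}`
(`gaussian_wick_one` applied to `φ_q F` and then to `∂_a F`). [folklore] -/
theorem gaussian_wick_two :
    ∀ (ι : Type) [Fintype ι] [DecidableEq ι] (P : Matrix ι ι ℝ), P.PosDef → ∀ (m : ℕ) (K : ℝ) (F : (ι → ℝ) → ℝ) (F₁ : ι → (ι → ℝ) → ℝ) (F₂ : ι → ι → (ι → ℝ) → ℝ), AEStronglyMeasurable F volume → (∀ a : ι, AEStronglyMeasurable (F₁ a) volume) → (∀ a b : ι, AEStronglyMeasurable (F₂ a b) volume) → (∀ φ : ι → ℝ, |F φ| ≤ K * (1 + ∑ i, φ i ^ 2) ^ m) → (∀ (a : ι) (φ : ι → ℝ), |F₁ a φ| ≤ K * (1 + ∑ i, φ i ^ 2) ^ m) → (∀ (a b : ι) (φ : ι → ℝ), |F₂ a b φ| ≤ K * (1 + ∑ i, φ i ^ 2) ^ m) → (∀ (a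 : ι) (φ : ι → ℝ), HasDerivAt (fun t : ℝ => F (Function.update φ a t)) (F₁ a φ) (φ a)) → (∀ (a b : ι) (φ : ι → ℝ), HasDerivAt (fun t : ℝ => F₁ a (Function.update φ b t)) (F₂ a b φ) (φ b)) → ∀ p q : ι, ∫ φ : ι → ℝ, φ p * φ q * F φ * Real.exp (-(φ ⬝ᵥ (P *ᵥ φ)) / 2) = P⁻¹ p q * (∫ φ : ι → ℝ, F φ * Real.exp (-(φ ⬝ᵥ (P *ᵥ φ)) / 2)) + ∑ a : ι, ∑ b : ι, P⁻¹ p a * P⁻¹ q b * ∫ φ : ι → ℝ, F₂ a b φ * Real.exp (-(φ ⬝ᵥ (P *ᵥ φ)) / 2) := by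
  intro ι _ _ P hP m K F F₁ F₂ hFm hF₁m hF₂m hFb hF₁b hF₂b hderiv hderiv₂ p q
  have hK : 0 ≤ K := nonneg_of_bound hFb
  have hwcont : Continuous fun φ : ι → ℝ => Real.exp (-(φ ⬝ᵥ (P *ᵥ φ)) / 2) := by
    refine Real.continuous_exp.comp ((Continuous.neg ?_).div_const _)
    exact continuous_id.dotProduct (Continuous.matrix_mulVec continuous_const continuous_id)
  have hcoord : AEStronglyMeasurable (fun φ : ι → ℝ => φ q) volume :=
    (continuous_apply q).aestronglyMeasurable
  -- the observable `G = φ_q F` and its partial derivatives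
  set G : (ι → ℝ) → ℝ := fun φ => φ q * F φ with hG
  set G₁ : ι → (ι → ℝ) → ℝ := fun a φ => (if a = q then (1 : ℝ) else 0) * F φ + φ q * F₁ a φ with hG₁
  have hGm : AEStronglyMeasurable G volume := hcoord.mul hFm
  have hG₁m : ∀ a, AEStronglyMeasurable (G₁ a) volume := fun a =>
    (aestronglyMeasurable_const.mul hFm).add (hcoord.mul (hF₁m a))
  have hGb : ∀ φ : ι → ℝ, |G φ| ≤ (2 * K) * (1 + ∑ i, φ i ^ 2) ^ (m + 1) := fun φ => by
    have h := bound_coord_mul hFb q φ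
    have hs : 0 ≤ ∑ i, φ i ^ 2 := Finset.sum_nonneg fun i _ => sq_nonneg _
    have : K * (1 + ∑ i, φ i ^ 2) ^ (m + 1) ≤ (2 * K) * (1 + ∑ i, φ i ^ 2) ^ (m + 1) := by
      have : 0 ≤ K * (1 + ∑ i, φ i ^ 2) ^ (m + 1) := by positivity
      linarith
    exact h.trans this
  have hG₁b : ∀ (a : ι) (φ : ι → ℝ), |G₁ a φ| ≤ (2 * K) * (1 + ∑ i, φ i ^ 2) ^ (m + 1) := fun a φ => by
    have h1 : |(if a = q then (1 : ℝ) else 0) * F φ| ≤ K * (1 + ∑ i, φ i ^ 2) ^ (m + 1) := by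
      have hF' := bound_mono hFb φ
      have hs : 0 ≤ ∑ i, φ i ^ 2 := Finset.sum_nonneg fun i _ => sq_nonneg _
      split_ifs
      · simpa using hF'
      · simp only [zero_mul, abs_zero]; positivity
    have h2 := bound_coord_mul (hF₁b a) q φ
    calc |G₁ a φ| ≤ |(if a = q then (1 : ℝ) else 0) * F φ| + |φ q * F₁ a φ| := abs_add_le _ _
      _ ≤ K * (1 + ∑ i, φ i ^ 2) ^ (m + 1) + K * (1 + ∑ i, φ i ^ 2) ^ (m + 1) := add_le_add h1 h2
      _ = (2 * K) * (1 + ∑ i, φ i ^ 2) ^ (m + 1) := by ring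
  have hGderiv : ∀ (a : ι) (φ : ι → ℝ), HasDerivAt (fun t : ℝ => G (Function.update φ a t)) (G₁ a φ) (φ a) := by
    intro a φ
    by_cases haq : a = q
    · subst haq
      have hfun : (fun t : ℝ => G (Function.update φ a t)) = fun t => t * F (Function.update φ a t) := by
        funext t; simp [hG]
      rw [hfun]
      have h := (hasDerivAt_id (φ a)).mul (hderiv a φ)
      rw [Function.update_eq_self] at h
      refine h.congr_deriv ?_
      simp [hG₁]
    · have hfun : (fun t : ℝ => G (Function.update φ a t)) = fun t => φ q * F (Function.update φ a t) := by
        funext t; simp [hG, Function.update_of_ne (Ne.symm haq)]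
      rw [hfun]
      refine ((hderiv a φ).const_mul (φ q)).congr_deriv ?_
      simp [hG₁, haq]
  -- first-order Wick for `G` and for each `∂_a F`
  have hW := gaussian_wick_one ι P hP (m + 1) (2 * K) G G₁ hGm hG₁m hGb hG₁b hGderiv p
  have hW₁ : ∀ a, ∫ φ : ι → ℝ, φ q * F₁ a φ * Real.exp (-(φ ⬝ᵥ (P *ᵥ φ)) / 2) =
      ∑ b, P⁻¹ q b * ∫ φ : ι → ℝ, F₂ a b φ * Real.exp (-(φ ⬝ᵥ (P *ᵥ φ)) / 2) := fun a =>
    gaussian_wick_one ι P hP m K (F₁ a) (F₂ a) (hF₁m a) (hF₂m a) (hF₁b a) (hF₂b a) (hderiv₂ a) q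
  -- integrability of the two pieces of `G₁ a`
  have hiF : Integrable (fun φ : ι → ℝ => F φ * Real.exp (-(φ ⬝ᵥ (P *ᵥ φ)) / 2)) :=
    integrable_polyGrowth_mul_gaussian ι P hP m K F hFm hFb
  have hiqF₁ : ∀ a, Integrable (fun φ : ι → ℝ => φ q * F₁ a φ * Real.exp (-(φ ⬝ᵥ (P *ᵥ φ)) / 2)) := fun a =>
    integrable_polyGrowth_mul_gaussian ι P hP (m + 1) K (fun φ => φ q * F₁ a φ) (hcoord.mul (hF₁m a))
      (bound_coord_mul (hF₁b a) q)
  have hsplit : ∀ a, ∫ φ : ι → ℝ, G₁ a φ * Real.exp (-(φ ⬝ᵥ (P *ᵥ φ)) / 2) =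
      (if a = q then (1 : ℝ) else 0) * (∫ φ : ι → ℝ, F φ * Real.exp (-(φ ⬝ᵥ (P *ᵥ φ)) / 2)) +
        ∑ b, P⁻¹ q b * ∫ φ : ι → ℝ, F₂ a b φ * Real.exp (-(φ ⬝ᵥ (P *ᵥ φ)) / 2) := by
    intro a
    rw [← hW₁ a, ← integral_const_mul, ← integral_add ((hiF.const_mul _)) (hiqF₁ a)]
    refine integral_congr_ae (Filter.Eventually.of_forall fun φ => ?_)
    simp only [hG₁]
    ring
  have hLHS : ∫ φ : ι → ℝ, φ p * φ q * F φ * Real.exp (-(φ ⬝ᵥ (P *ᵥ φ)) / 2) =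
      ∫ φ : ι → ℝ, φ p * G φ * Real.exp (-(φ ⬝ᵥ (P *ᵥ φ)) / 2) :=
    integral_congr_ae (Filter.Eventually.of_forall fun φ => by simp only [hG]; ring)
  rw [hLHS, hW]
  simp_rw [hsplit, mul_add, Finset.sum_add_distrib, Finset.mul_sum]
  congr 1
  · simp [Finset.sum_ite_eq', ite_mul, mul_ite]
  · exact Finset.sum_congr rfl fun a _ => Finset.sum_congr rfl fun b _ => by ring

/-- **Wick's rule for a quadratic insertion.** For a positive definite precision matrix `P`, any
matrix `D` and `F` in the polynomial-growth class with first and second coordinate partial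
derivatives in the same class:
`∫ (φᵀDφ) F e^{−½φᵀPφ} = (Σ_{p,q} D_{pq} P⁻¹_{pq}) ∫ F e^{−½φᵀPφ} + Σ_{a,b} (P⁻¹DP⁻¹)_{ab} ∫ ∂_b∂_a F e^{−½φᵀPφ}`.
Since `d/ds e^{−½φᵀ(P+sD)φ} = −½ (φᵀDφ) e^{−½φᵀ(P+sD)φ}` and `d/ds (P+sD)⁻¹ = −P⁻¹DP⁻¹`, this is the
integrand of the Gaussian interpolation (heat-kernel) formula of the decoupling expansion.
[folklore] -/
theorem gaussian_wick_quadForm :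
    ∀ (ι : Type) [Fintype ι] [DecidableEq ι] (P : Matrix ι ι ℝ), P.PosDef → ∀ (m : ℕ) (K : ℝ) (F : (ι → ℝ) → ℝ) (F₁ : ι → (ι → ℝ) → ℝ) (F₂ : ι → ι → (ι → ℝ) → ℝ), AEStronglyMeasurable F volume → (∀ a : ι, AEStronglyMeasurable (F₁ a) volume) → (∀ a b : ι, AEStronglyMeasurable (F₂ a b) volume) → (∀ φ : ι → ℝ, |F φ| ≤ K * (1 + ∑ i, φ i ^ 2) ^ m) → (∀ (a : ι) (φ : ι → ℝ), |F₁ a φ| ≤ K * (1 + ∑ i, φ i ^ 2) ^ m) → (∀ (a b : ι) (φ : ι → ℝ), |F₂ a b φ| ≤ K * (1 + ∑ i, φ i ^ 2) ^ m) → (∀ (a : ι) (φ : ι → ℝ), HasDerivAt (fun t : ℝ => F (Function.update φ a t)) (F₁ a φ) (φ a)) → (∀ (a b : ι) (φ : ι → ℝ), HasDerivAt (fun t : ℝ => F₁ a (Function.update φ b t)) (F₂ a b φ) (φ b)) → ∀ D : Matrix ι ι ℝ, ∫ φ : ι → ℝ, (φ ⬝ᵥ (D *ᵥ φ)) * F φ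 * Real.exp (-(φ ⬝ᵥ (P *ᵥ φ)) / 2) = (∑ p : ι, ∑ q : ι, D p q * P⁻¹ p q) * (∫ φ : ι → ℝ, F φ * Real.exp (-(φ ⬝ᵥ (P *ᵥ φ)) / 2)) + ∑ a : ι, ∑ b : ι, (P⁻¹ * D * P⁻¹) a b * ∫ φ : ι → ℝ, F₂ a b φ * Real.exp (-(φ ⬝ᵥ (P *ᵥ φ)) / 2) := by
  intro ι _ _ P hP m K F F₁ F₂ hFm hF₁m hF₂m hFb hF₁b hF₂b hderiv hderiv₂ D
  have hsymm : P.IsSymm := Matrix.isHermitian_iff_isSymm.1 hP.isHermitian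
  have hCsymm : ∀ a b : ι, P⁻¹ a b = P⁻¹ b a := fun a b => by
    rw [← Matrix.transpose_apply P⁻¹ b a, Matrix.transpose_nonsing_inv, hsymm.eq]
  have hW₂ := gaussian_wick_two ι P hP m K F F₁ F₂ hFm hF₁m hF₂m hFb hF₁b hF₂b hderiv hderiv₂
  -- integrability of `φ_p φ_q F w`
  have hipq : ∀ p q : ι, Integrable (fun φ : ι → ℝ => φ p * φ q * F φ * Real.exp (-(φ ⬝ᵥ (P *ᵥ φ)) / 2)) := by
    intro p q
    have h := integrable_polyGrowth_mul_gaussian ι P hP (m + 1 + 1) K (fun φ => φ p * (φ q * F φ))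
      ((continuous_apply p).aestronglyMeasurable.mul ((continuous_apply q).aestronglyMeasurable.mul hFm))
      (bound_coord_mul (bound_coord_mul hFb q) p)
    refine h.congr (Filter.Eventually.of_forall fun φ => ?_)
    simp only []
    ring
  -- expand the quadratic form
  have hquad : ∀ φ : ι → ℝ, (φ ⬝ᵥ (D *ᵥ φ)) * F φ * Real.exp (-(φ ⬝ᵥ (P *ᵥ φ)) / 2) =
      ∑ p, ∑ q, D p q * (φ p * φ q * F φ * Real.exp (-(φ ⬝ᵥ (P *ᵥ φ)) / 2)) := by
    intro φ
    have : φ ⬝ᵥ (D *ᵥ φ) = ∑ p, ∑ q, D p q * (φ p * φ q) := by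
      simp only [dotProduct, Matrix.mulVec, Finset.mul_sum]
      exact Finset.sum_congr rfl fun p _ => Finset.sum_congr rfl fun q _ => by ring
    rw [this, Finset.sum_mul, Finset.sum_mul]
    refine Finset.sum_congr rfl fun p _ => ?_
    rw [Finset.sum_mul, Finset.sum_mul]
    exact Finset.sum_congr rfl fun q _ => by ring
  have hstep : ∫ φ : ι → ℝ, (φ ⬝ᵥ (D *ᵥ φ)) * F φ * Real.exp (-(φ ⬝ᵥ (P *ᵥ φ)) / 2) =
      ∑ p, ∑ q, D p q * ∫ φ : ι → ℝ, φ p * φ q * F φ * Real.exp (-(φ ⬝ᵥ (P *ᵥ φ)) / 2) := by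
    rw [integral_congr_ae (Filter.Eventually.of_forall hquad)]
    rw [integral_finsetSum _ fun p _ => integrable_finsetSum _ fun q _ => (hipq p q).const_mul _]
    refine Finset.sum_congr rfl fun p _ => ?_
    rw [integral_finsetSum _ fun q _ => (hipq p q).const_mul _]
    exact Finset.sum_congr rfl fun q _ => integral_const_mul _ _
  rw [hstep]
  simp_rw [hW₂, mul_add, Finset.sum_add_distrib]
  congr 1
  · rw [Finset.sum_mul]
    refine Finset.sum_congr rfl fun p _ => ?_
    rw [Finset.sum_mul]
    exact Finset.sum_congr rfl fun q _ => by ring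
  · -- `Σ_{p,q} D_{pq} Σ_{a,b} P⁻¹_{pa} P⁻¹_{qb} I_{ab} = Σ_{a,b} (P⁻¹DP⁻¹)_{ab} I_{ab}`
    have hM : ∀ a b : ι, (P⁻¹ * D * P⁻¹) a b = ∑ p, ∑ q, P⁻¹ p a * D p q * P⁻¹ q b := by
      intro a b
      rw [Matrix.mul_apply]
      simp_rw [Matrix.mul_apply, Finset.sum_mul]
      rw [Finset.sum_comm]
      exact Finset.sum_congr rfl fun p _ => Finset.sum_congr rfl fun q _ => by rw [hCsymm a p]
    simp_rw [hM, Finset.sum_mul, Finset.mul_sum]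
    -- reorder the four sums on the right: `Σ_a Σ_b Σ_p Σ_q → Σ_p Σ_q Σ_a Σ_b`
    symm
    calc ∑ a, ∑ b, ∑ p, ∑ q, P⁻¹ p a * D p q * P⁻¹ q b * ∫ φ : ι → ℝ, F₂ a b φ * Real.exp (-(φ ⬝ᵥ (P *ᵥ φ)) / 2)
        = ∑ a, ∑ p, ∑ b, ∑ q, P⁻¹ p a * D p q * P⁻¹ q b * ∫ φ : ι → ℝ, F₂ a b φ * Real.exp (-(φ ⬝ᵥ (P *ᵥ φ)) / 2) :=
          Finset.sum_congr rfl fun a _ => Finset.sum_comm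
      _ = ∑ p, ∑ a, ∑ b, ∑ q, P⁻¹ p a * D p q * P⁻¹ q b * ∫ φ : ι → ℝ, F₂ a b φ * Real.exp (-(φ ⬝ᵥ (P *ᵥ φ)) / 2) :=
          Finset.sum_comm
      _ = ∑ p, ∑ a, ∑ q, ∑ b, P⁻¹ p a * D p q * P⁻¹ q b * ∫ φ : ι → ℝ, F₂ a b φ * Real.exp (-(φ ⬝ᵥ (P *ᵥ φ)) / 2) :=
          Finset.sum_congr rfl fun p _ => Finset.sum_congr rfl fun a _ => Finset.sum_comm
      _ = ∑ p, ∑ q, ∑ a, ∑ b, P⁻¹ p a * D p q * P⁻¹ q b * ∫ φ : ι → ℝ, F₂ a b φ * Real.exp (-(φ ⬝ᵥ (P *ᵥ φ)) / 2) :=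
          Finset.sum_congr rfl fun p _ => Finset.sum_comm
      _ = ∑ p, ∑ q, ∑ a, ∑ b, D p q * (P⁻¹ p a * P⁻¹ q b * ∫ φ : ι → ℝ, F₂ a b φ * Real.exp (-(φ ⬝ᵥ (P *ᵥ φ)) / 2)) :=
          Finset.sum_congr rfl fun p _ => Finset.sum_congr rfl fun q _ => Finset.sum_congr rfl fun a _ =>
            Finset.sum_congr rfl fun b _ => by ring

end Summit.QuantumFields.YangMills.Theorems.AnchorGap

end
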